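import Summits.BirchSwinnertonDyer.BirchSwinnertonDyer.Theorems.ByReductionTypeAtTwoFineSelmerConjAAtTwoAdditivePotGoodChevalleyStampsA
import Summits.BirchSwinnertonDyer.BirchSwinnertonDyer.Theorems.ByReductionTypeAtTwoFineSelmerConjAAtTwoAdditivePotGoodTwoLayerStampsEvenIndexA
import Summits.BirchSwinnertonDyer.BirchSwinnertonDyer.Theorems.ByReductionTypeAtTwoFineSelmerConjAAtTwoAdditivePotGoodTwoLayerStampsEvenIndexB
import HarnessLib

/-!
# Route `ByReductionTypeAtTwo` (rung K4), crux C1″ `FineSelmerConjAAtTwoAdditivePotGood` (item stmt-BirchSwinnertonDyer-22615):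
# IWASAWA `μ₂ = 0`, KERNEL, BY NAME, for the cubic point fields of the census rows with TWO primes above `2` or EVEN class number
# and `Δ_cubic < 0` — part A (Chevalley no-bit rows, even-index stamps) (a `--supports 22615` file; seat `bsd-2adic-k4-w1` GEN 8, lane (c) «capitulation/Chevalley rows» of pen RC-472)

HONEST FRAMING (cell `bsd-2adic`, D-0036/D-0054/D-0152): THEOREMS ONLY (no definition, no named fact, no `sorry`); each theorem
`classicalMu_two_<L>` is PROVED OUTRIGHT: Iwasawa's classical `μ₂` vanishes (growth form `ClassicalMuVanishes`) along every cyclotomic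
`ℤ₂`-extension of the cubic field `ℚ(θ)` = the `2`-torsion point field of the census curve `<L>` (an `S₃`-cubic field with `2 = 𝔭²𝔮`,
`2 = 𝔭₁𝔭₂` or even class number — OUTSIDE Iwasawa 1956). These statements were so far BURIED inside `conjA_two_<L> hLim2` (GEN 5–7); they are
the `hμ` input of cruxlead-19573-w2 GEN 7's «Iwasawa ℓ = 2 ascent with real places» to the totally complex `ℚ(E[2]) = ℚ(θ, √Δ)` (Δ < 0 on
every row here), after which w2's kernel Lim 3.5@2 (p723148) yields (A)₂ for these rows WITHOUT `hLim2`. This file closes nothing at the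
`∀`-level; nothing booked; it is number theory about cubic fields — BSD is not proved by any of this.

MECHANISM (all kernel, GEN 5–7 by name): Chevalley rows — `layerOneBit_of_chevalleyCert` (`e₁ = 0` from a `2`-adically certified non-norm
unit, ≤ 2 primes above `2`) + `classicalMuVanishes_two_adjoin_of_evenIndexCertificate` (`n₀ = 0` by the even-index certificate, Fukuda
Thm. 1 (1)); capitulation rows — `classNumberPExp_one_eq_zero_layer_d…` (`e₁ = e₀` by the capitulation certificate) +
`forall_totallyRamifiedFrom_zero_adjoin_of_…` + `classicalMuVanishes_of_classNumberPExp_succ_eq fukuda1994_…_holds`.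
Rows here: `237952bv1` (d = -104) · `244416cn1` (d = -804) · `434964b1` (d = -804).

References: [Fukuda1994] Thm. 1 (1); [Lang1990] Ch. 13 §4; [Greenberg2001IwasawaPastPresent] Prop. 2.1, §4; [Washington1997] §13.
-/

set_option autoImplicit false
-- sibling precedent (`…GenusDoorCubic.lean`): the directory name repeats the summit name
set_option linter.dupNamespace false

noncomputable section

open scoped Classical IntermediateField NumberField

namespace Summit.BirchSwinnertonDyer.BirchSwinnertonDyer.Theorems.AddKatoTwo

open WeierstrassCurve Field Polynomial IsDedekindDomain NumberField Matrix Literature.NumberTheory.EllipticCurves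
  Literature.NumberTheory.GaloisRepresentations
  Literature.NumberTheory.IwasawaTheory
  Summit.BirchSwinnertonDyer.BirchSwinnertonDyer.Theorems.AlignedTransportAtTwoTorsionPointField
  Summit.BirchSwinnertonDyer.BirchSwinnertonDyer.Theses.ByReductionTypeAtTwo

/-- **Iwasawa's `μ₂ = 0` for the cubic field of the census row `237952bv1` (`d = -104`, TWO primes above `2`), KERNEL — every cyclotomic
`ℤ₂`-extension of `ℚ(θ)` has `μ = 0` (growth form).** The `hμ`-core of `conjA_two_237952bv1 hLim2` exposed by name: Chevalley's door at `2`
(`layerOneBit_of_chevalleyCert`: `e₁ = 0` from a non-norm unit) + the even-index certificate (`n₀ = 0`) + Fukuda 1994 Thm. 1 (1); NO Lim fact,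
no displayed datum. Input of cruxlead-19573-w2's ℓ = 2 ascent to `ℚ(E[2])` (Δ < 0). [cite: Fukuda1994, Thm. 1 (1), p. 264]
[cite: Lang1990, Ch. 13 §4, Lemma 4.1] [cite: Greenberg2001IwasawaPastPresent, §4 (Iwasawa's μ-conjecture)] -/
theorem classicalMu_two_237952bv1 {θ : AlgebraicClosure ℚ} (hθ : aeval θ (Cubic.toPoly ⟨1, ((0 : ℤ) : ℚ), ((-1 : ℤ) : ℚ), ((-2 : ℤ) : ℚ)⟩) = 0) :
    haveI : FiniteDimensional ℚ (IntermediateField.adjoin ℚ {θ}) :=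
      IntermediateField.adjoin.finiteDimensional ((AlgebraicClosure.isAlgebraic ℚ).isAlgebraic θ).isIntegral
    haveI : NumberField (IntermediateField.adjoin ℚ {θ}) := NumberField.mk
    ∀ κL : ZpExtension (IntermediateField.adjoin ℚ {θ}) 2, κL.IsCyclotomic → ClassicalMuVanishes κL := by
  intro κL hκL
  have hθ' : θ ^ 3 + (0 : AlgebraicClosure ℚ) * θ ^ 2 + (-1 : AlgebraicClosure ℚ) * θ + (-2 : AlgebraicClosure ℚ) = 0 := by
    have := hθ
    simp only [Cubic.toPoly, map_one, one_mul, aeval_add, aeval_mul, aeval_C, aeval_X_pow, aeval_X,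
      eq_ratCast, Rat.cast_intCast] at this
    push_cast at this
    linear_combination this
  have he : aeval (algebraMap ℚ (AlgebraicClosure ℚ) (((-1 : ℤ) : ℚ) / ((1 : ℤ) : ℚ)) +
      algebraMap ℚ (AlgebraicClosure ℚ) (((-1 : ℤ) : ℚ) / ((1 : ℤ) : ℚ)) * θ +
      algebraMap ℚ (AlgebraicClosure ℚ) (((1 : ℤ) : ℚ) / ((1 : ℤ) : ℚ)) * θ ^ 2)
      (Cubic.toPoly ⟨1, ((1 : ℤ) : ℚ), ((5 : ℤ) : ℚ), ((1 : ℤ) : ℚ)⟩) = 0 := by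
    simp only [Cubic.toPoly, map_one, one_mul, aeval_add, aeval_mul, aeval_C, aeval_X_pow, aeval_X, eq_ratCast,
      Rat.cast_intCast, Rat.cast_div]
    push_cast
    linear_combination ((2 : AlgebraicClosure ℚ) + (2 : AlgebraicClosure ℚ) * θ + (-3 : AlgebraicClosure ℚ) * θ ^ 2 + (1 : AlgebraicClosure ℚ) * θ ^ 3) * hθ'
  have h1 := layerOneBit_of_chevalleyCert irreducible_cubic_d104n hθ (by rw [card_classGroup_adjoin_eq_one_disc_neg104 hθ]; norm_num) ⟨0, by norm_num⟩ ⟨0, by norm_num⟩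
      (-1) (-1) (1) (1) (1) (5) (1) (by norm_num) he (6) (1) (by norm_num) (by norm_num) (by decide) (by decide)
  have hirr := irreducible_cubic_d104n
  haveI : FiniteDimensional ℚ (IntermediateField.adjoin ℚ {θ}) :=
    IntermediateField.adjoin.finiteDimensional ((AlgebraicClosure.isAlgebraic ℚ).isAlgebraic θ).isIntegral
  haveI : NumberField (IntermediateField.adjoin ℚ {θ}) := NumberField.mk
  obtain ⟨B, -, hB⟩ := exists_ringOfIntegers_cubic_root (p := 0) (q := -1) (r := -2) hθ
  have h3 := finrank_adjoin_eq_three_of_irreducible hirr hθ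
  refine classicalMuVanishes_two_adjoin_of_evenIndexCertificate (p := 0) (q := -1) (r := -2) hirr hθ
    (((-2 : ℤ) : 𝓞 (IntermediateField.adjoin ℚ {θ})) + ((-1 : ℤ) : 𝓞 (IntermediateField.adjoin ℚ {θ})) * B + ((-1 : ℤ) : 𝓞 (IntermediateField.adjoin ℚ {θ})) * B ^ 2) (((0 : ℤ) : 𝓞 (IntermediateField.adjoin ℚ {θ})) + ((0 : ℤ) : 𝓞 (IntermediateField.adjoin ℚ {θ})) * B + ((-1 : ℤ) : 𝓞 (IntermediateField.adjoin ℚ {θ})) * B ^ 2) (((2 : ℤ) : 𝓞 (IntermediateField.adjoin ℚ {θ})) + ((1 : ℤ) : 𝓞 (IntermediateField.adjoin ℚ {θ})) * B + ((1 : ℤ) : 𝓞 (IntermediateField.adjoin ℚ {θ})) * B ^ 2) (((4 : ℤ) : 𝓞 (IntermediateField.adjoin ℚ {θ})) + ((4 : ℤ) : 𝓞 (IntermediateField.adjoin ℚ {θ})) * B + ((3 : ℤ) : 𝓞 (IntermediateField.adjoin ℚ {θ})) * B ^ 2) ?_ ?_ ?_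
    (by rw [card_classGroup_adjoin_eq_one_disc_neg104 hθ]; norm_num) κL hκL (h1 κL hκL)
  · push_cast; linear_combination (((2 : ℤ) : 𝓞 (IntermediateField.adjoin ℚ {θ})) + ((-1 : ℤ) : 𝓞 (IntermediateField.adjoin ℚ {θ})) * B) * hB
  · push_cast; linear_combination (((2 : ℤ) : 𝓞 (IntermediateField.adjoin ℚ {θ})) + ((1 : ℤ) : 𝓞 (IntermediateField.adjoin ℚ {θ})) * B) * hB
  · have hz : (2 : 𝓞 (IntermediateField.adjoin ℚ {θ})) - (((4 : ℤ) : 𝓞 (IntermediateField.adjoin ℚ {θ})) + ((4 : ℤ) : 𝓞 (IntermediateField.adjoin ℚ {θ})) * B + ((3 : ℤ) : 𝓞 (IntermediateField.adjoin ℚ {θ})) * B ^ 2) ^ 3 =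
        ((-1090 : ℤ) : 𝓞 (IntermediateField.adjoin ℚ {θ})) + (-1264 : ℤ) * B + (-831 : ℤ) * B ^ 2 := by
      push_cast; linear_combination (((-514 : ℤ) : 𝓞 (IntermediateField.adjoin ℚ {θ})) + ((-279 : ℤ) : 𝓞 (IntermediateField.adjoin ℚ {θ})) * B + ((-108 : ℤ) : 𝓞 (IntermediateField.adjoin ℚ {θ})) * B ^ 2 + ((-27 : ℤ) : 𝓞 (IntermediateField.adjoin ℚ {θ})) * B ^ 3) * hB
    rw [hz]
    exact not_eight_dvd_norm_coords _ h3 B hirr hB (-1090) (-1264) (-831) (N := -24734)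
      (by simp only [Matrix.one_fin_three, Matrix.det_fin_three, Matrix.add_apply, Matrix.smul_apply, sq, Matrix.mul_apply,
        Fin.sum_univ_three, Matrix.of_apply, Matrix.cons_val', Matrix.cons_val_zero, Matrix.cons_val_one, Matrix.cons_val_two,
        Matrix.head_cons, Matrix.tail_cons, Matrix.empty_val', Matrix.cons_val_fin_one, smul_eq_mul]; norm_num) (by norm_num)

/-- **Iwasawa's `μ₂ = 0` for the cubic field of the census row `244416cn1` (`d = -804`, TWO primes above `2`), KERNEL — every cyclotomic
`ℤ₂`-extension of `ℚ(θ)` has `μ = 0` (growth form).** The `hμ`-core of `conjA_two_244416cn1 hLim2` exposed by name: Chevalley's door at `2`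
(`layerOneBit_of_chevalleyCert`: `e₁ = 0` from a non-norm unit) + the even-index certificate (`n₀ = 0`) + Fukuda 1994 Thm. 1 (1); NO Lim fact,
no displayed datum. Input of cruxlead-19573-w2's ℓ = 2 ascent to `ℚ(E[2])` (Δ < 0). [cite: Fukuda1994, Thm. 1 (1), p. 264]
[cite: Lang1990, Ch. 13 §4, Lemma 4.1] [cite: Greenberg2001IwasawaPastPresent, §4 (Iwasawa's μ-conjecture)] -/
theorem classicalMu_two_244416cn1 {θ : AlgebraicClosure ℚ} (hθ : aeval θ (Cubic.toPoly ⟨1, ((-1 : ℤ) : ℚ), ((4 : ℤ) : ℚ), ((-6 : ℤ) : ℚ)⟩) = 0) :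
    haveI : FiniteDimensional ℚ (IntermediateField.adjoin ℚ {θ}) :=
      IntermediateField.adjoin.finiteDimensional ((AlgebraicClosure.isAlgebraic ℚ).isAlgebraic θ).isIntegral
    haveI : NumberField (IntermediateField.adjoin ℚ {θ}) := NumberField.mk
    ∀ κL : ZpExtension (IntermediateField.adjoin ℚ {θ}) 2, κL.IsCyclotomic → ClassicalMuVanishes κL := by
  intro κL hκL
  have hθ' : θ ^ 3 + (-1 : AlgebraicClosure ℚ) * θ ^ 2 + (4 : AlgebraicClosure ℚ) * θ + (-6 : AlgebraicClosure ℚ) = 0 := by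
    have := hθ
    simp only [Cubic.toPoly, map_one, one_mul, aeval_add, aeval_mul, aeval_C, aeval_X_pow, aeval_X,
      eq_ratCast, Rat.cast_intCast] at this
    push_cast at this
    linear_combination this
  have he : aeval (algebraMap ℚ (AlgebraicClosure ℚ) (((19 : ℤ) : ℚ) / ((1 : ℤ) : ℚ)) +
      algebraMap ℚ (AlgebraicClosure ℚ) (((2 : ℤ) : ℚ) / ((1 : ℤ) : ℚ)) * θ +
      algebraMap ℚ (AlgebraicClosure ℚ) (((-12 : ℤ) : ℚ) / ((1 : ℤ) : ℚ)) * θ ^ 2)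
      (Cubic.toPoly ⟨1, ((-143 : ℤ) : ℚ), ((5279 : ℤ) : ℚ), ((-1 : ℤ) : ℚ)⟩) = 0 := by
    simp only [Cubic.toPoly, map_one, one_mul, aeval_add, aeval_mul, aeval_C, aeval_X_pow, aeval_X, eq_ratCast,
      Rat.cast_intCast, Rat.cast_div]
    push_cast
    linear_combination ((-9256 : AlgebraicClosure ℚ) + (-6480 : AlgebraicClosure ℚ) * θ + (-864 : AlgebraicClosure ℚ) * θ ^ 2 + (-1728 : AlgebraicClosure ℚ) * θ ^ 3) * hθ'
  have h1 := layerOneBit_of_chevalleyCert irreducible_cubic_d804n hθ (by rw [card_classGroup_adjoin_eq_one_disc_neg804 hθ]; norm_num) ⟨0, by norm_num⟩ ⟨0, by norm_num⟩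
      (19) (2) (-12) (1) (-143) (5279) (-1) (by norm_num) he (3) (1) (by norm_num) (by norm_num) (by decide) (by decide)
  have hirr := irreducible_cubic_d804n
  haveI : FiniteDimensional ℚ (IntermediateField.adjoin ℚ {θ}) :=
    IntermediateField.adjoin.finiteDimensional ((AlgebraicClosure.isAlgebraic ℚ).isAlgebraic θ).isIntegral
  haveI : NumberField (IntermediateField.adjoin ℚ {θ}) := NumberField.mk
  obtain ⟨B, -, hB⟩ := exists_ringOfIntegers_cubic_root (p := -1) (q := 4) (r := -6) hθ
  have h3 := finrank_adjoin_eq_three_of_irreducible hirr hθ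
  refine classicalMuVanishes_two_adjoin_of_evenIndexCertificate (p := -1) (q := 4) (r := -6) hirr hθ
    (((-2 : ℤ) : 𝓞 (IntermediateField.adjoin ℚ {θ})) + ((-2 : ℤ) : 𝓞 (IntermediateField.adjoin ℚ {θ})) * B + ((0 : ℤ) : 𝓞 (IntermediateField.adjoin ℚ {θ})) * B ^ 2) (((0 : ℤ) : 𝓞 (IntermediateField.adjoin ℚ {θ})) + ((-1 : ℤ) : 𝓞 (IntermediateField.adjoin ℚ {θ})) * B + ((-1 : ℤ) : 𝓞 (IntermediateField.adjoin ℚ {θ})) * B ^ 2) (((-8 : ℤ) : 𝓞 (IntermediateField.adjoin ℚ {θ})) + ((5 : ℤ) : 𝓞 (IntermediateField.adjoin ℚ {θ})) * B + ((1 : ℤ) : 𝓞 (IntermediateField.adjoin ℚ {θ})) * B ^ 2) (((65 : ℤ) : 𝓞 (IntermediateField.adjoin ℚ {θ})) + ((-59 : ℤ) : 𝓞 (IntermediateField.adjoin ℚ {θ})) * B + ((8 : ℤ) : 𝓞 (IntermediateField.adjoin ℚ {θ})) * B ^ 2) ?_ ?_ ?_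
    (by rw [card_classGroup_adjoin_eq_one_disc_neg804 hθ]; norm_num) κL hκL (h1 κL hκL)
  · push_cast; linear_combination (((-6 : ℤ) : 𝓞 (IntermediateField.adjoin ℚ {θ})) + ((-2 : ℤ) : 𝓞 (IntermediateField.adjoin ℚ {θ})) * B) * hB
  · push_cast; linear_combination (((11 : ℤ) : 𝓞 (IntermediateField.adjoin ℚ {θ})) + ((1 : ℤ) : 𝓞 (IntermediateField.adjoin ℚ {θ})) * B) * hB
  · have hz : (2 : 𝓞 (IntermediateField.adjoin ℚ {θ})) - (((65 : ℤ) : 𝓞 (IntermediateField.adjoin ℚ {θ})) + ((-59 : ℤ) : 𝓞 (IntermediateField.adjoin ℚ {θ})) * B + ((8 : ℤ) : 𝓞 (IntermediateField.adjoin ℚ {θ})) * B ^ 2) ^ 3 =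
        ((1285155 : ℤ) : 𝓞 (IntermediateField.adjoin ℚ {θ})) + (-790987 : ℤ) * B + (-122696 : ℤ) * B ^ 2 := by
      push_cast; linear_combination (((259963 : ℤ) : 𝓞 (IntermediateField.adjoin ℚ {θ})) + ((-83160 : ℤ) : 𝓞 (IntermediateField.adjoin ℚ {θ})) * B + ((10816 : ℤ) : 𝓞 (IntermediateField.adjoin ℚ {θ})) * B ^ 2 + ((-512 : ℤ) : 𝓞 (IntermediateField.adjoin ℚ {θ})) * B ^ 3) * hB
    rw [hz]
    exact not_eight_dvd_norm_coords _ h3 B hirr hB (1285155) (-790987) (-122696) (N := 12649572874794)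
      (by simp only [Matrix.one_fin_three, Matrix.det_fin_three, Matrix.add_apply, Matrix.smul_apply, sq, Matrix.mul_apply,
        Fin.sum_univ_three, Matrix.of_apply, Matrix.cons_val', Matrix.cons_val_zero, Matrix.cons_val_one, Matrix.cons_val_two,
        Matrix.head_cons, Matrix.tail_cons, Matrix.empty_val', Matrix.cons_val_fin_one, smul_eq_mul]; norm_num) (by norm_num)

/-- **Iwasawa's `μ₂ = 0` for the cubic field of the census row `434964b1` (`d = -804`, TWO primes above `2`), KERNEL — every cyclotomic
`ℤ₂`-extension of `ℚ(θ)` has `μ = 0` (growth form).** The `hμ`-core of `conjA_two_434964b1 hLim2` exposed by name: Chevalley's door at `2`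
(`layerOneBit_of_chevalleyCert`: `e₁ = 0` from a non-norm unit) + the even-index certificate (`n₀ = 0`) + Fukuda 1994 Thm. 1 (1); NO Lim fact,
no displayed datum. Input of cruxlead-19573-w2's ℓ = 2 ascent to `ℚ(E[2])` (Δ < 0). [cite: Fukuda1994, Thm. 1 (1), p. 264]
[cite: Lang1990, Ch. 13 §4, Lemma 4.1] [cite: Greenberg2001IwasawaPastPresent, §4 (Iwasawa's μ-conjecture)] -/
theorem classicalMu_two_434964b1 {θ : AlgebraicClosure ℚ} (hθ : aeval θ (Cubic.toPoly ⟨1, ((-1 : ℤ) : ℚ), ((4 : ℤ) : ℚ), ((-6 : ℤ) : ℚ)⟩) = 0) :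
    haveI : FiniteDimensional ℚ (IntermediateField.adjoin ℚ {θ}) :=
      IntermediateField.adjoin.finiteDimensional ((AlgebraicClosure.isAlgebraic ℚ).isAlgebraic θ).isIntegral
    haveI : NumberField (IntermediateField.adjoin ℚ {θ}) := NumberField.mk
    ∀ κL : ZpExtension (IntermediateField.adjoin ℚ {θ}) 2, κL.IsCyclotomic → ClassicalMuVanishes κL := by
  intro κL hκL
  have hθ' : θ ^ 3 + (-1 : AlgebraicClosure ℚ) * θ ^ 2 + (4 : AlgebraicClosure ℚ) * θ + (-6 : AlgebraicClosure ℚ) = 0 := by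
    have := hθ
    simp only [Cubic.toPoly, map_one, one_mul, aeval_add, aeval_mul, aeval_C, aeval_X_pow, aeval_X,
      eq_ratCast, Rat.cast_intCast] at this
    push_cast at this
    linear_combination this
  have he : aeval (algebraMap ℚ (AlgebraicClosure ℚ) (((19 : ℤ) : ℚ) / ((1 : ℤ) : ℚ)) +
      algebraMap ℚ (AlgebraicClosure ℚ) (((2 : ℤ) : ℚ) / ((1 : ℤ) : ℚ)) * θ +
      algebraMap ℚ (AlgebraicClosure ℚ) (((-12 : ℤ) : ℚ) / ((1 : ℤ) : ℚ)) * θ ^ 2)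
      (Cubic.toPoly ⟨1, ((-143 : ℤ) : ℚ), ((5279 : ℤ) : ℚ), ((-1 : ℤ) : ℚ)⟩) = 0 := by
    simp only [Cubic.toPoly, map_one, one_mul, aeval_add, aeval_mul, aeval_C, aeval_X_pow, aeval_X, eq_ratCast,
      Rat.cast_intCast, Rat.cast_div]
    push_cast
    linear_combination ((-9256 : AlgebraicClosure ℚ) + (-6480 : AlgebraicClosure ℚ) * θ + (-864 : AlgebraicClosure ℚ) * θ ^ 2 + (-1728 : AlgebraicClosure ℚ) * θ ^ 3) * hθ'
  have h1 := layerOneBit_of_chevalleyCert irreducible_cubic_d804n hθ (by rw [card_classGroup_adjoin_eq_one_disc_neg804 hθ]; norm_num) ⟨0, by norm_num⟩ ⟨0, by norm_num⟩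
      (19) (2) (-12) (1) (-143) (5279) (-1) (by norm_num) he (3) (1) (by norm_num) (by norm_num) (by decide) (by decide)
  have hirr := irreducible_cubic_d804n
  haveI : FiniteDimensional ℚ (IntermediateField.adjoin ℚ {θ}) :=
    IntermediateField.adjoin.finiteDimensional ((AlgebraicClosure.isAlgebraic ℚ).isAlgebraic θ).isIntegral
  haveI : NumberField (IntermediateField.adjoin ℚ {θ}) := NumberField.mk
  obtain ⟨B, -, hB⟩ := exists_ringOfIntegers_cubic_root (p := -1) (q := 4) (r := -6) hθ
  have h3 := finrank_adjoin_eq_three_of_irreducible hirr hθ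
  refine classicalMuVanishes_two_adjoin_of_evenIndexCertificate (p := -1) (q := 4) (r := -6) hirr hθ
    (((-2 : ℤ) : 𝓞 (IntermediateField.adjoin ℚ {θ})) + ((-2 : ℤ) : 𝓞 (IntermediateField.adjoin ℚ {θ})) * B + ((0 : ℤ) : 𝓞 (IntermediateField.adjoin ℚ {θ})) * B ^ 2) (((0 : ℤ) : 𝓞 (IntermediateField.adjoin ℚ {θ})) + ((-1 : ℤ) : 𝓞 (IntermediateField.adjoin ℚ {θ})) * B + ((-1 : ℤ) : 𝓞 (IntermediateField.adjoin ℚ {θ})) * B ^ 2) (((-8 : ℤ) : 𝓞 (IntermediateField.adjoin ℚ {θ})) + ((5 : ℤ) : 𝓞 (IntermediateField.adjoin ℚ {θ})) * B + ((1 : ℤ) : 𝓞 (IntermediateField.adjoin ℚ {θ})) * B ^ 2) (((65 : ℤ) : 𝓞 (IntermediateField.adjoin ℚ {θ})) + ((-59 : ℤ) : 𝓞 (IntermediateField.adjoin ℚ {θ})) * B + ((8 : ℤ) : 𝓞 (IntermediateField.adjoin ℚ {θ})) * B ^ 2) ?_ ?_ ?_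
    (by rw [card_classGroup_adjoin_eq_one_disc_neg804 hθ]; norm_num) κL hκL (h1 κL hκL)
  · push_cast; linear_combination (((-6 : ℤ) : 𝓞 (IntermediateField.adjoin ℚ {θ})) + ((-2 : ℤ) : 𝓞 (IntermediateField.adjoin ℚ {θ})) * B) * hB
  · push_cast; linear_combination (((11 : ℤ) : 𝓞 (IntermediateField.adjoin ℚ {θ})) + ((1 : ℤ) : 𝓞 (IntermediateField.adjoin ℚ {θ})) * B) * hB
  · have hz : (2 : 𝓞 (IntermediateField.adjoin ℚ {θ})) - (((65 : ℤ) : 𝓞 (IntermediateField.adjoin ℚ {θ})) + ((-59 : ℤ) : 𝓞 (IntermediateField.adjoin ℚ {θ})) * B + ((8 : ℤ) : 𝓞 (IntermediateField.adjoin ℚ {θ})) * B ^ 2) ^ 3 =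
        ((1285155 : ℤ) : 𝓞 (IntermediateField.adjoin ℚ {θ})) + (-790987 : ℤ) * B + (-122696 : ℤ) * B ^ 2 := by
      push_cast; linear_combination (((259963 : ℤ) : 𝓞 (IntermediateField.adjoin ℚ {θ})) + ((-83160 : ℤ) : 𝓞 (IntermediateField.adjoin ℚ {θ})) * B + ((10816 : ℤ) : 𝓞 (IntermediateField.adjoin ℚ {θ})) * B ^ 2 + ((-512 : ℤ) : 𝓞 (IntermediateField.adjoin ℚ {θ})) * B ^ 3) * hB
    rw [hz]
    exact not_eight_dvd_norm_coords _ h3 B hirr hB (1285155) (-790987) (-122696) (N := 12649572874794)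
      (by simp only [Matrix.one_fin_three, Matrix.det_fin_three, Matrix.add_apply, Matrix.smul_apply, sq, Matrix.mul_apply,
        Fin.sum_univ_three, Matrix.of_apply, Matrix.cons_val', Matrix.cons_val_zero, Matrix.cons_val_one, Matrix.cons_val_two,
        Matrix.head_cons, Matrix.tail_cons, Matrix.empty_val', Matrix.cons_val_fin_one, smul_eq_mul]; norm_num) (by norm_num)

end Summit.BirchSwinnertonDyer.BirchSwinnertonDyer.Theorems.AddKatoTwo

end
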